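import Summits.HubbardSuperconductivity.HubbardSuperconductivity.Theorems.BirGroundStateAverageLRO.Negative.PairingCost
import Literature.MathematicalPhysics.QuantumLattice.FreeFermiGasPairingCostOptimal

/-!
# Crux `BirGroundStateAverageLRO` (item `stmt-HubbardSuperconductivity-2079`): the window floor at the rate `c^{3/2}`

The crux (`Theses.BalabanIR.BirGroundStateAverageLRO`, route BalabanIR, target / rank 0) asks, on a
window of couplings `0 < U₁ < U < U₂`, eventually in even `L`, the ground-state-AVERAGE `d`-wave pair
LRO `c·L⁴·Re tr P ≤ Re tr (P Δ_d† Δ_d)` for the projection `P` onto the ground eigenspace of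
`hubbardTorus 2 L 1 U` in the sector `(2⌊(1-δ)L²/2⌋, S^z = 0)`.

`Negative/PairingCost.lean` / `Negative/PairingCostSharp.lean` derived the UNCONDITIONAL window
floors `4·(min(c,1)/48)⁶ ≤ U₁` and `(min(c,1)/8192)² ≤ U₁` from the sextic / quadratic pairing-cost
rates. The rate is now `a^{3/2}` (`Literature/…/FreeFermiGasPairingCostOptimal.lean`,
`freeDWavePairing_costs_energy_opt_rate`: `d`-wave pair density `a` in a unit vector of
`szSector N 0` costs free kinetic energy `≥ (a√a/32768)·L²` once `L ≥ ⌈1536/a⌉ + 3` — triangle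
bounds for the pair operator, exact bathtub identity, one Cauchy–Schwarz against `Σ 1/|ξ_k|`), and
every consequence sharpens accordingly (negative side only; nothing asserts a Theses decl; every
mutated statement is spelled out):

* `avgBound_coupling_floor_opt` — POINTWISE: the crux's inequality at ONE datum `(δ, U, c, L)` with
  `δ ≥ -1`, `U ≥ 0`, `c > 0`, `L ≥ ⌈1536/c⌉ + 3` forces `c√c/32768 ≤ U`; equivalently
  (`avgBound_density_cube_le`) `c³ ≤ 2³⁰·U²`, i.e. the ground-state-average `d`-wave pair density of
  the repulsive Hubbard torus is `≤ 1024·U^{2/3}` (was `O(√U)`; no `min(c,1)` any more).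
* `birGroundStateAverageLRO_window_floor_opt` / `…_witness_floor_opt` / `…_witness_cube_le` —
  every witness `(δ, U₁, U₂, c)` of the crux (indeed of its weakening with `0 ≤ U₁`) satisfies
  `c√c/32768 ≤ U₁`, i.e. `c³ ≤ 2³⁰ U₁²`.
* `pairingCostWitnessFloorOpt` — the one-line registered form (stub of crux `stmt-…-2079`).

Regime map for the planners / the standing disprover: an engine for the crux must output a constant
`c(U₁) ≤ 1024·U₁^{2/3}` (and `≤ 32`, `Disproof.lean` §2); the expected truth is `e^{-O(1/U)}`-small
(`PerturbativeInvisibilityOfPairing`). With the first-order kinetic budget `U·L²` the remaining slack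
is only the density of states at the Fermi level: the linear level count away from half filling
would give `c ≲ U log(1/U)`, the Bardeen–Cooper–Schrieffer rate.

Sources: Bardeen–Cooper–Schrieffer, Phys. Rev. 108 (1957) 1175, §II; C. N. Yang, Rev. Mod. Phys. 34
(1962) 694, §3; Tasaki (2020) §2.2 (variational principle). Folklore finite-dimensional statements;
no named facts, no definitions.
-/

noncomputable section

namespace Summit.HubbardSuperconductivity.HubbardSuperconductivity.Theorems.BirGroundStateAverageLRO.Negative

open Matrix Finset Filter
open Literature.Probability.LatticeModels Literature.MathematicalPhysics.QuantumLattice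
open Summit.HubbardSuperconductivity.HubbardSuperconductivity.Theorems
open scoped ComplexOrder

/-- **Pointwise coupling floor, rate `c^{3/2}`.** If the crux's ground-state-average bound
`c·L⁴·Re tr P ≤ Re tr (P Δ_d†Δ_d)` holds at ONE datum `(δ, U, c, L)` with `δ ≥ -1`, `U ≥ 0`, `c > 0`
and `L ≥ ⌈1536/c⌉ + 3`, then `c√c/32768 ≤ U`: a sector ground state carrying the bound
(`exists_groundState_le_of_trace_bound`) has free-energy excess `≤ U·L²`
(`re_free_energy_groundState_le`) and `≥ (c√c/32768)·L²` (`freeDWavePairing_costs_energy_opt_rate`).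
[folklore] -/
theorem avgBound_coupling_floor_opt (L : ℕ) [NeZero L] {δ U c : ℝ} (hδ : -1 ≤ δ) (hU : 0 ≤ U)
    (hc : 0 < c) (hL : ⌈1536 / c⌉₊ + 3 ≤ L)
    (h : let N : ℕ := 2 * ⌊(1 - δ) * (L : ℝ) ^ 2 / 2⌋₊
      let H := hubbardTorus 2 L 1 U
      let S := szSector (Λ := FermionTorus 2 L) N 0
      let E₀ := S ⊓ Module.End.eigenspace (Matrix.toLin' H) ((H.minEnergyOn S : ℝ) : ℂ)
      let P := projMatrix (E₀.map (Fock.toEuclidean (ι := Orb (FermionTorus 2 L)) :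
        Fock (Orb (FermionTorus 2 L)) →ₗ[ℂ] EuclideanSpace ℂ (Finset (Orb (FermionTorus 2 L)))))
      c * (L : ℝ) ^ 4 * P.trace.re ≤
        (P * ((pairField dWaveFormFactor L)ᴴ * pairField dWaveFormFactor L)).trace.re) :
    c * Real.sqrt c / 32768 ≤ U := by
  obtain ⟨ψ, hgs, h1, hle⟩ := exists_groundState_le_of_trace_bound L 1 U δ c hδ h
  have hn := NoGo.floor_pairNumber_le δ hδ L
  have hcost := freeDWavePairing_costs_energy_opt_rate hc hL hgs.1 h1 hle
  have hfree := re_free_energy_groundState_le L 1 U hU hn hgs h1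
  have hL2 : (0 : ℝ) < (L : ℝ) ^ 2 := by
    have : (0 : ℝ) < (L : ℝ) := by exact_mod_cast Nat.pos_of_ne_zero (NeZero.ne L)
    positivity
  have hmul : c * Real.sqrt c / 32768 * (L : ℝ) ^ 2 ≤ U * (L : ℝ) ^ 2 := by linarith
  exact le_of_mul_le_mul_right hmul hL2

/-- **The ground-state-average `d`-wave pair density is `O(U^{2/3})`.** Under the hypotheses of
`avgBound_coupling_floor_opt` (the crux's inequality at one datum `(δ, U, c, L)`, `δ ≥ -1`, `U ≥ 0`,
`c > 0`, `L ≥ ⌈1536/c⌉ + 3`): `c³ ≤ 2³⁰·U²` (i.e. `c ≤ 1024·U^{2/3}`). [folklore] -/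
theorem avgBound_density_cube_le (L : ℕ) [NeZero L] {δ U c : ℝ} (hδ : -1 ≤ δ)
    (hU : 0 ≤ U) (hc : 0 < c) (hL : ⌈1536 / c⌉₊ + 3 ≤ L)
    (h : let N : ℕ := 2 * ⌊(1 - δ) * (L : ℝ) ^ 2 / 2⌋₊
      let H := hubbardTorus 2 L 1 U
      let S := szSector (Λ := FermionTorus 2 L) N 0
      let E₀ := S ⊓ Module.End.eigenspace (Matrix.toLin' H) ((H.minEnergyOn S : ℝ) : ℂ)
      let P := projMatrix (E₀.map (Fock.toEuclidean (ι := Orb (FermionTorus 2 L)) :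
        Fock (Orb (FermionTorus 2 L)) →ₗ[ℂ] EuclideanSpace ℂ (Finset (Orb (FermionTorus 2 L)))))
      c * (L : ℝ) ^ 4 * P.trace.re ≤
        (P * ((pairField dWaveFormFactor L)ᴴ * pairField dWaveFormFactor L)).trace.re) :
    c ^ 3 ≤ 2 ^ 30 * U ^ 2 := by
  have hfl := avgBound_coupling_floor_opt L hδ hU hc hL h
  have h0 : 0 ≤ c * Real.sqrt c := by positivity
  have h' : c * Real.sqrt c ≤ 32768 * U := by linarith
  have h2 := pow_le_pow_left₀ h0 h' 2
  rw [mul_pow, Real.sq_sqrt hc.le, mul_pow] at h2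
  calc c ^ 3 = c ^ 2 * c := by ring
    _ ≤ 32768 ^ 2 * U ^ 2 := h2
    _ = 2 ^ 30 * U ^ 2 := by norm_num

/-- **Window floor for `BirGroundStateAverageLRO`, rate `c^{3/2}`.** If the crux's average bound
with constant `c > 0` holds eventually in even `L` at every coupling of an interval `(U₁, U₂)`,
`0 ≤ U₁ < U₂` (`δ ∈ (0,1/2)`), then `c√c/32768 ≤ U₁`
(`LoadBearing.birGroundStateAverageLRO_window_floor` with the `a^{3/2}` energy-cost rate).
[folklore] -/
theorem birGroundStateAverageLRO_window_floor_opt {δ U₁ U₂ c : ℝ}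
    (hδ : δ ∈ Set.Ioo (0:ℝ) (1/2)) (hU₁ : 0 ≤ U₁) (hU : U₁ < U₂) (hc : 0 < c)
    (h : ∀ U ∈ Set.Ioo U₁ U₂, ∃ L₀ : ℕ, ∀ (L : ℕ) [NeZero L], L₀ ≤ L → Even L →
      let N : ℕ := 2 * ⌊(1 - δ) * (L : ℝ) ^ 2 / 2⌋₊
      let H := hubbardTorus 2 L 1 U
      let S := szSector (Λ := FermionTorus 2 L) N 0
      let E₀ := S ⊓ Module.End.eigenspace (Matrix.toLin' H) ((H.minEnergyOn S : ℝ) : ℂ)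
      let P := projMatrix (E₀.map (Fock.toEuclidean (ι := Orb (FermionTorus 2 L)) :
        Fock (Orb (FermionTorus 2 L)) →ₗ[ℂ] EuclideanSpace ℂ (Finset (Orb (FermionTorus 2 L)))))
      c * (L : ℝ) ^ 4 * P.trace.re ≤
        (P * ((pairField dWaveFormFactor L)ᴴ * pairField dWaveFormFactor L)).trace.re) :
    c * Real.sqrt c / 32768 ≤ U₁ :=
  birGroundStateAverageLRO_window_floor hδ hU₁ hU h (η := c * Real.sqrt c / 32768)
    (L₁ := ⌈1536 / c⌉₊ + 3)
    (fun _ _ hL _ _ hS h1 hle => freeDWavePairing_costs_energy_opt_rate hc hL hS h1 hle)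

/-- **Corollary for the crux itself, rate `c^{3/2}`.** Any witness `(δ, U₁, U₂, c)` of
`BirGroundStateAverageLRO` (with its `0 < U₁`) has `c√c/32768 ≤ U₁`. [folklore] -/
theorem birGroundStateAverageLRO_witness_floor_opt {δ U₁ U₂ c : ℝ}
    (hδ : δ ∈ Set.Ioo (0:ℝ) (1/2)) (hU₁ : 0 < U₁) (hU : U₁ < U₂) (hc : 0 < c)
    (h : ∀ U ∈ Set.Ioo U₁ U₂, ∃ L₀ : ℕ, ∀ (L : ℕ) [NeZero L], L₀ ≤ L → Even L →
      let N : ℕ := 2 * ⌊(1 - δ) * (L : ℝ) ^ 2 / 2⌋₊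
      let H := hubbardTorus 2 L 1 U
      let S := szSector (Λ := FermionTorus 2 L) N 0
      let E₀ := S ⊓ Module.End.eigenspace (Matrix.toLin' H) ((H.minEnergyOn S : ℝ) : ℂ)
      let P := projMatrix (E₀.map (Fock.toEuclidean (ι := Orb (FermionTorus 2 L)) :
        Fock (Orb (FermionTorus 2 L)) →ₗ[ℂ] EuclideanSpace ℂ (Finset (Orb (FermionTorus 2 L)))))
      c * (L : ℝ) ^ 4 * P.trace.re ≤
        (P * ((pairField dWaveFormFactor L)ᴴ * pairField dWaveFormFactor L)).trace.re) :
    c * Real.sqrt c / 32768 ≤ U₁ :=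
  birGroundStateAverageLRO_window_floor_opt hδ hU₁.le hU hc h

/-- **Every witness of the crux has `c³ ≤ 2³⁰·U₁²`** (`c ≤ 1024·U₁^{2/3}`): the admissible LRO
constant of `BirGroundStateAverageLRO` is `O(U₁^{2/3})` in the lower edge of its window. [folklore] -/
theorem birGroundStateAverageLRO_witness_cube_le {δ U₁ U₂ c : ℝ}
    (hδ : δ ∈ Set.Ioo (0:ℝ) (1/2)) (hU₁ : 0 < U₁) (hU : U₁ < U₂) (hc : 0 < c)
    (h : ∀ U ∈ Set.Ioo U₁ U₂, ∃ L₀ : ℕ, ∀ (L : ℕ) [NeZero L], L₀ ≤ L → Even L →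
      let N : ℕ := 2 * ⌊(1 - δ) * (L : ℝ) ^ 2 / 2⌋₊
      let H := hubbardTorus 2 L 1 U
      let S := szSector (Λ := FermionTorus 2 L) N 0
      let E₀ := S ⊓ Module.End.eigenspace (Matrix.toLin' H) ((H.minEnergyOn S : ℝ) : ℂ)
      let P := projMatrix (E₀.map (Fock.toEuclidean (ι := Orb (FermionTorus 2 L)) :
        Fock (Orb (FermionTorus 2 L)) →ₗ[ℂ] EuclideanSpace ℂ (Finset (Orb (FermionTorus 2 L)))))
      c * (L : ℝ) ^ 4 * P.trace.re ≤
        (P * ((pairField dWaveFormFactor L)ᴴ * pairField dWaveFormFactor L)).trace.re) :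
    c ^ 3 ≤ 2 ^ 30 * U₁ ^ 2 := by
  have hfl := birGroundStateAverageLRO_witness_floor_opt hδ hU₁ hU hc h
  have h0 : 0 ≤ c * Real.sqrt c := by positivity
  have h' : c * Real.sqrt c ≤ 32768 * U₁ := by linarith
  have h2 := pow_le_pow_left₀ h0 h' 2
  rw [mul_pow, Real.sq_sqrt hc.le, mul_pow] at h2
  calc c ^ 3 = c ^ 2 * c := by ring
    _ ≤ 32768 ^ 2 * U₁ ^ 2 := h2
    _ = 2 ^ 30 * U₁ ^ 2 := by norm_num

/-- **Registered stub `pairingCostWitnessFloorOpt` (crux `stmt-HubbardSuperconductivity-2079`).**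
Every witness `(δ, U₁, U₂, c)` of the crux satisfies the UNCONDITIONAL coupling floor
`c√c/32768 ≤ U₁` (`birGroundStateAverageLRO_witness_floor_opt`, one-line registered form).
[folklore] -/
theorem pairingCostWitnessFloorOpt : ∀ (δ U₁ U₂ c : ℝ), δ ∈ Set.Ioo (0:ℝ) (1/2) → 0 < U₁ → U₁ < U₂ → 0 < c → (∀ U ∈ Set.Ioo U₁ U₂, ∃ L₀ : ℕ, ∀ (L : ℕ) [NeZero L], L₀ ≤ L → Even L → let N : ℕ := 2 * ⌊(1 - δ) * (L : ℝ) ^ 2 / 2⌋₊; let H := Literature.MathematicalPhysics.QuantumLattice.hubbardTorus 2 L 1 U; let S := Literature.MathematicalPhysics.QuantumLattice.szSector (Λ := Literature.MathematicalPhysics.QuantumLattice.FermionTorus 2 L) N 0; let E₀ := S ⊓ Module.End.eigenspace (Matrix.toLin' H) ((H.minEnergyOn S : ℝ) : ℂ); let P := Literature.MathematicalPhysics.QuantumLattice.projMatrix (E₀.map (Literature.MathematicalPhysics.QuantumLattice.Fock.toEuclidean (ι := Literature.MathematicalPhysics.QuantumLattice.Orb (Literature.MathematicalPhysics.QuantumLattice.FermionTorus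 2 L)) : Literature.MathematicalPhysics.QuantumLattice.Fock (Literature.MathematicalPhysics.QuantumLattice.Orb (Literature.MathematicalPhysics.QuantumLattice.FermionTorus 2 L)) →ₗ[ℂ] EuclideanSpace ℂ (Finset (Literature.MathematicalPhysics.QuantumLattice.Orb (Literature.MathematicalPhysics.QuantumLattice.FermionTorus 2 L))))); c * (L : ℝ) ^ 4 * P.trace.re ≤ (P * (Matrix.conjTranspose (Literature.MathematicalPhysics.QuantumLattice.pairField Literature.MathematicalPhysics.QuantumLattice.dWaveFormFactor L) * Literature.MathematicalPhysics.QuantumLattice.pairField Literature.MathematicalPhysics.QuantumLattice.dWaveFormFactor L)).trace.re) → c * Real.sqrt c / 32768 ≤ U₁ :=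
  fun _ _ _ _ hδ hU₁ hU hc h => birGroundStateAverageLRO_witness_floor_opt hδ hU₁ hU hc h

end Summit.HubbardSuperconductivity.HubbardSuperconductivity.Theorems.BirGroundStateAverageLRO.Negative
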